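import Literature.NumberTheory.PAdicHodge.DeRhamRestrictedTateRepTower
import Literature.NumberTheory.PAdicHodge.DeRhamEllipticGoodOrdinary
import Literature.NumberTheory.GaloisRepresentations.ToLocalRestrictField
import HarnessLib

/-!
# `V_pW|_{Γ_{K_v}}` is de Rham as soon as `W` acquires good ORDINARY reduction at a place `v' ∣ v` of a finite
# extension `K'/K` — the potentially-good-ordinary sector of hDR at additive places

Topic `NumberTheory/PAdicHodge`; theorems only (no definition, no named fact, no instance).

For an elliptic curve `W` over a number field `K`, a prime `p`, a place `v ∣ p` of `K` (possibly of BAD, e.g. additive,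
reduction) and a finite extension `K'/K` with a place `v' ∣ v` at which `W ×_K K'` has good ORDINARY reduction:
**`restrictedRationalTateRep W (K_v) p` is de Rham for `B_dR(K_v)`** (any `ℚ_p`-algebra structure on `K_v`),
`isDeRham_restrictedRationalTateRep_of_goodOrdinary_above`. Assembly of tree theorems:

1. `isDeRham_restrictedRationalTateRep_of_goodOrdinary` (Greenberg's ordinary filtration ⇒ de Rham, file
   `DeRhamEllipticGoodOrdinary`) for `W ×_K K'` at `v'`: `V_p(W_{K'})|_{Γ_{K'_{v'}}}` is de Rham;
2. base change `V_p(W_{K'}) ≅ V_pW|_{Γ_{K'}}` (`rationalTateModuleEquiv`, `TateModuleBaseChange`) and the tower lemma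
   `GaloisRep.isAdmissible_restrictField_restrictField_iff` (`K ⊆ K' ⊆ K'_{v'}` and `K ⊆ K_v ⊆ K'_{v'}`):
   `(V_pW|_{Γ_{K_v}})|_{Γ_{K'_{v'}}}` is de Rham for `B_dR(K'_{v'})`;
3. de Rham DESCENT along the continuous `K_v → K'_{v'}` (`isDeRham_of_isDeRham_restrictField`, Brinon–Conrad 6.3.8 in
   the module dialect, file `DeRhamDescentModule`).

Motivation: the BSD crux K★ `stmt-BirchSwinnertonDyer-22226` (stub hDR `isDeRham_restrictedRationalTateRep`) concerns
`W/ℚ` with ADDITIVE potentially good reduction at `p ∈ {5, 7}` (Kodaira IV*, III*, II*); over `K' = ℚ(p^{1/e})`,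
`e ∈ {3, 4, 6}`, the curve has good reduction, ordinary or supersingular according to `j̃ ∈ {0, 1728}` and `p mod 12`.
This file closes the ORDINARY half at `F = ℚ_p` GIVEN the number-field witness `(K', v')`; with
`isDeRham_restrictedRationalTateRep_iff_of_tower` it propagates to every finite extension of `ℚ_p`. The supersingular
half needs both `p`-adic periods (not here). BSD is not proved by any of this; hDR stays cite-only.

## References

* [Greenberg1991] R. Greenberg, *Iwasawa theory for p-adic representations*, §2.
* [BrinonConrad2009] O. Brinon, B. Conrad (2009), Prop. 6.3.8.
* [SerreTate1968] J.-P. Serre, J. Tate, *Good reduction of abelian varieties*, Ann. of Math. 88 (1968), §2.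
-/

noncomputable section

open Field ValuativeRel NumberField IsDedekindDomain

namespace Literature.NumberTheory.PAdicHodge

open Literature.NumberTheory.GaloisRepresentations
open Literature.NumberTheory.GaloisRepresentations.IsNonarchimedeanLocalField
open Literature.NumberTheory.EllipticCurves WeierstrassCurve
open Literature.NumberTheory.Automorphic

/-- **Potentially good ORDINARY ⇒ de Rham at the completion.** Let `W/K` be an elliptic curve over a number field,
`v ∣ p` a place of `K`, `K'/K` finite with a place `v' ∣ v` at which `W ×_K K'` has good ordinary reduction
(`HasGoodReductionAt`, `p ∤ a_{v'}`). Then `V_pW|_{Γ_{K_v}}` is de Rham for `B_dR(K_v)`.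
[cite: Greenberg1991, §2] [cite: BrinonConrad2009, Prop. 6.3.8] [cite: SerreTate1968, §2] -/
theorem isDeRham_restrictedRationalTateRep_of_goodOrdinary_above
    {K : Type} [Field K] [NumberField K] (W : WeierstrassCurve K) [W.IsElliptic] {p : ℕ} [Fact p.Prime]
    {K' : Type} [Field K'] [NumberField K'] [Algebra K K']
    (v : HeightOneSpectrum (𝓞 K)) (v' : HeightOneSpectrum (𝓞 K')) [v'.asIdeal.LiesOver v.asIdeal]
    (hv' : (p : 𝓞 K') ∈ v'.asIdeal)
    (hgood : (W.baseChange K').HasGoodReductionAt v') (hord : ¬ ((p : ℤ) ∣ (W.baseChange K').frobeniusTraceAt v'))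
    [CharZero (v.adicCompletion K)] [Fact (¬ IsUnit (p : integerC (v.adicCompletion K)))]
    [IsAdicComplete (Ideal.span {(p : integerC (v.adicCompletion K))}) (integerC (v.adicCompletion K))]
    (hp : valuation (v.adicCompletion K) p < 1) [Algebra ℚ_[p] (v.adicCompletion K)] :
    GaloisRep.IsDeRham (bdRPeriodRingData (F := v.adicCompletion K) (p := p) hp)
      (restrictedRationalTateRep W (v.adicCompletion K) p) := by
  -- the `p`-adic field `F = K'_{v'}` and its structures
  have hp' : valuation (v'.adicCompletion K') (p : v'.adicCompletion K') < 1 :=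
    LocalField.valuation_adicCompletion_natCast_lt_one v' p hv'
  haveI : CharZero (v'.adicCompletion K') := LocalField.charZero_adicCompletion v'
  haveI : Fact (¬ IsUnit ((p : ℕ) : integerC (v'.adicCompletion K'))) := ⟨not_isUnit_natCast_integerC hp'⟩
  haveI : IsAdicComplete (Ideal.span {((p : ℕ) : integerC (v'.adicCompletion K'))}) (integerC (v'.adicCompletion K')) :=
    isAdicComplete_integerC_natCast hp'
  letI : Algebra ℚ_[p] (v'.adicCompletion K') := LocalField.padicAlgebra (v'.adicCompletion K') p hp'
  letI : Algebra (v.adicCompletion K) (v'.adicCompletion K') := (adicCompletionOfLiesOver K K' v v').toAlgebra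
  haveI : IsScalarTower K (v.adicCompletion K) (v'.adicCompletion K') := isScalarTower_adicCompletionOfLiesOver v v'
  haveI : Module.Finite ℚ_[p] (W.rationalTateModule p) := W.finite_rationalTateModule p
  set 𝔅 := bdRPeriodRingData (F := v'.adicCompletion K') (p := p) hp' with h𝔅
  set ρ := W.rationalTateGaloisRep p (W.continuous_rationalGaloisRepTate_holds p) with hρ
  -- (1) the ordinary theorem for `W ×_K K'` at `v'`
  have h1 : GaloisRep.IsDeRham 𝔅 (restrictedRationalTateRep (W.baseChange K') (v'.adicCompletion K') p) :=
    isDeRham_restrictedRationalTateRep_of_goodOrdinary (W.baseChange K') v' hv' hgood hord hp'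
  -- (2a) base change `V_p(W_{K'})|_{Γ_{K'_{v'}}} ≅ (V_pW|_{Γ_{K'}})|_{Γ_{K'_{v'}}}`
  have h2 : 𝔅.IsAdmissible ((ρ.restrictField K').restrictField (v'.adicCompletion K')) := by
    refine (𝔅.isAdmissible_iff_of_equiv ((ρ.restrictField K').restrictField (v'.adicCompletion K'))
      (restrictedRationalTateRep (W.baseChange K') (v'.adicCompletion K') p)
      (rationalTateModuleEquiv W K' p) fun σ x => ?_).2 h1
    exact rationalTateModuleEquiv_rationalGaloisRepTate W K' p (absGaloisRestrict K' (v'.adicCompletion K') σ) x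
  -- (2b) towers: `K ⊆ K' ⊆ K'_{v'}` and `K ⊆ K_v ⊆ K'_{v'}`
  have h3 : 𝔅.IsAdmissible (ρ.restrictField (v'.adicCompletion K')) :=
    (GaloisRep.isAdmissible_restrictField_restrictField_iff (K₀ := K) (F₀ := K') 𝔅 ρ).1 h2
  have h4 : 𝔅.IsAdmissible ((ρ.restrictField (v.adicCompletion K)).restrictField (v'.adicCompletion K')) :=
    (GaloisRep.isAdmissible_restrictField_restrictField_iff (K₀ := K) (F₀ := v.adicCompletion K) 𝔅 ρ).2 h3
  -- (3) descent along `K_v → K'_{v'}`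
  exact isDeRham_of_isDeRham_restrictField (K := v.adicCompletion K) (L := v'.adicCompletion K')
    (continuous_adicCompletionOfLiesOver K K' v v') hp hp' (restrictedRationalTateRep W (v.adicCompletion K) p) h4

end Literature.NumberTheory.PAdicHodge

end
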